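import Literature.RepresentationTheory.BorelWallach2000.U11PrincipalSeriesLoewy
import Literature.Algebra.Module.Uniserial
import HarnessLib

/-!
# The principal series `P(s, λ)` of `U(1,1)` is uniserial: height `=` length `=` Loewy length, and the socle series is its only
# composition series (Bump Thm. 2.5.3–2.5.4; Anderson–Fuller Lemma 32.1; Krause Lemma 13.1.26)

Family `hodge`, lane `lit-hodgefound` (foundations library; seat `lit-hodgefound-p39`, generation 33, row g33-#17); topic
`RepresentationTheory/BorelWallach2000`, namespace `…BorelWallach2000.U11PS` (continued).  Sequel of `U11PrincipalSeriesCompositionSeries`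
(`submodule_cases`, `length_eq_three/_two/_one`, `eq_series₃`), `U11PrincipalSeriesLoewy` (g33-#15: `socle_psMod`, `jacobson_psMod`,
`loewyLength_psMod`) and the generic g33-#16 `Algebra/Module/Uniserial` (`IsUniserial`, `IsUniserial.socleLength_eq_length`,
`IsUniserial.compositionSeries_eq_socleSeries`).  «Every composition series … IS `0 ⋖ W(a₂) ⋖ W(a₁) ⋖ P`» (tree, `eq_series₃`) is the
statement that `P(s, λ)` is UNISERIAL in Anderson–Fuller's sense; here this is recorded as `IsUniserial (GKRing G11) (psMod s λ)` for ALL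
`s`, `λ`, and the generic theory then yields `ht(P) = ℓ(P)` (`= 3`, `2`, `1`) and identifies every composition series with the socle series.
Theorems only (0 definitions), 0 `sorry`, no named fact (net debt 0, D-0026).

## The sources

D. Bump (1997) [Bump1997, Thm. 2.5.3 (i)–(iii), Thm. 2.5.4 (ii)]; F. W. Anderson, K. R. Fuller (1992) [AndersonFuller1992, §32, Lemma 32.1];
H. Krause (2021) [Krause2021, Lemma 13.1.26]; A. W. Knapp, D. A. Vogan (1995) [KnappVogan1995, App. A §3 Cor. A.27].

## What is formalised

* §1 **`isUniserial_psMod : IsUniserial (GKRing G11) (psMod s λ)`** (every `s`, `λ`), `isUniserial_upperR`, `isUniserial_quotient_psMod`.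
* §2 **`socleLength_psMod_eq_length : ht(P) = ℓ(P)`**, `socleLength_psMod = 3` (`a₁ < a₂`), `socleLength_psMod₂ = 2`, `socleLength_psMod_of_irreducible = 1`;
  `socleSeries_psMod_two = W(a₁)` (`a₁ < a₂`).
* §3 `compositionSeries_eq_socleSeries_psMod`: every composition series of `P(s, λ)` from `0` is the socle series term by term.

## Mathlib / Literature search

Tree: `U11PS.submodule_cases`, `upperR_le_upperR_iff`, `isSimpleModule_iff`, `length_eq_three/_two/_one`, `isArtinian_psMod`, `isNoetherian_psMod`
(g33-#15), `socle_psMod`, `loewyLength_psMod`; generic g33-#14/#16.  `rg -n 'isUniserial' BorelWallach2000` → nothing before this file.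

## References

* D. Bump, *Automorphic Forms and Representations* (1997), §2.5 Thm. 2.5.3, Thm. 2.5.4. [Bump1997]
* F. W. Anderson, K. R. Fuller, *Rings and Categories of Modules*, 2nd ed. (1992), §32, Lemma 32.1. [AndersonFuller1992]
* H. Krause, *Homological Theory of Representations* (2021), Lemma 13.1.26. [Krause2021]
* A. W. Knapp, D. A. Vogan, *Cohomological Induction and Unitary Representations* (1995), App. A §3 Cor. A.27. [KnappVogan1995]
-/

noncomputable section

open scoped Matrix ComplexConjugate

namespace Literature.RepresentationTheory.BorelWallach2000

open Literature.Algebra.Module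
open Literature.NumberTheory.Automorphic
open Literature.RepresentationTheory.KonnoKonno2007 Literature.RepresentationTheory.KonnoKonno2007.RealDualPair
open Literature.RepresentationTheory.KonnoKonno2007.RealDualPair.UForm
open U11HolDS

-- Mathlib idiom (as in `GKModules`, `GKModuleRing`): commutator bracket on `Module.End`
attribute [local instance 100] LieRing.ofAssociativeRing

-- carriers `↥W`, `M ⧸ W` over `GKRing G11` (as in `GKModuleRing` §7–§8)
set_option maxSynthPendingDepth 4

namespace U11PS

section Uniserial

variable {s : ℤ} {lam : ℂ}

/-! ## §1 `P(s, λ)` is uniserial -/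

/-- With zeros `a₁ ≤ a₂`: the four submodules `0, W(a₂), W(a₁), P` form a chain, so any two submodules are comparable.
[cite: Bump1997, Thm. 2.5.3 (ii)–(iii), Thm. 2.5.4 (ii)] [cite: AndersonFuller1992, §32] -/
theorem isUniserial_psMod_of_zeros {a₁ a₂ : ℤ} (h₁ : lc s lam a₁ = 0) (h₂ : lc s lam a₂ = 0) (h₁₂ : a₁ + a₂ = s + 1)
    (hle : a₁ ≤ a₂) : SocleRadical.IsUniserial (GKRing G11) (psMod s lam) := by
  have h21 : upperR h₂ ≤ upperR h₁ := (upperR_le_upperR_iff h₂ h₁).mpr hle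
  refine ⟨fun P Q => ?_⟩
  rcases submodule_cases h₁ h₂ h₁₂ P with rfl | rfl | rfl | rfl
  · exact Or.inl bot_le
  · rcases submodule_cases h₁ h₂ h₁₂ Q with rfl | rfl | rfl | rfl
    · exact Or.inr bot_le
    · exact Or.inl le_rfl
    · exact Or.inl h21
    · exact Or.inl le_top
  · rcases submodule_cases h₁ h₂ h₁₂ Q with rfl | rfl | rfl | rfl
    · exact Or.inr bot_le
    · exact Or.inr h21
    · exact Or.inl le_rfl
    · exact Or.inl le_top
  · exact Or.inr le_top

/-- **`P(s, λ)` is uniserial for every `s`, `λ`** (irreducible: trivially; reducible: the chain `0 < W(a₂) ≤ W(a₁) < P`).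
[cite: Bump1997, Thm. 2.5.3 (i)–(iii), Thm. 2.5.4 (ii)] [cite: AndersonFuller1992, §32, Lemma 32.1] -/
theorem isUniserial_psMod : SocleRadical.IsUniserial (GKRing G11) (psMod s lam) := by
  by_cases hirr : ∀ a : ℤ, lc s lam a ≠ 0
  · haveI : IsSimpleModule (GKRing G11) (psMod s lam) := isSimpleModule_iff.mpr hirr
    exact SocleRadical.IsUniserial.of_isSimpleModule
  · push Not at hirr
    obtain ⟨a₀, h⟩ := hirr
    obtain ⟨a₁, a₂, hle, h₁₂, h₁, h₂, -, -⟩ := exists_zeros_of_lc_eq_zero h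
    exact isUniserial_psMod_of_zeros h₁ h₂ h₁₂ hle

/-- The submodules `W(a)` are uniserial. [cite: AndersonFuller1992, §32] [cite: Bump1997, Thm. 2.5.3 (ii)] -/
theorem isUniserial_upperR {a₀ : ℤ} (h : lc s lam a₀ = 0) : SocleRadical.IsUniserial (GKRing G11) ↥(upperR h) :=
  isUniserial_psMod.submodule _

/-- The quotients `P / W` are uniserial. [cite: AndersonFuller1992, §32] [cite: Bump1997, Thm. 2.5.3 (iii)] -/
theorem isUniserial_quotient_psMod (W : Submodule (GKRing G11) (psMod s lam)) :
    SocleRadical.IsUniserial (GKRing G11) (psMod s lam ⧸ W) :=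
  isUniserial_psMod.quotient W

/-! ## §2 Height `=` length `=` Loewy length -/

/-- **`ht(P(s, λ)) = ℓ(P(s, λ))`**: the socle series of `P(s, λ)` is a composition series (Krause's criterion for uniserial objects).
[cite: Krause2021, Lemma 13.1.26] [cite: AndersonFuller1992, Lemma 32.1 (a)⇒(d)] -/
theorem socleLength_psMod_eq_length :
    (SocleRadical.socleLength (GKRing G11) (psMod s lam) : ℕ∞) = Module.length (GKRing G11) (psMod s lam) := by
  haveI := isArtinian_psMod (s := s) (lam := lam)
  haveI := isNoetherian_psMod (s := s) (lam := lam)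
  exact isUniserial_psMod.socleLength_eq_length

/-- `ht(P) = 3` for two distinct zeros. [cite: Bump1997, Thm. 2.5.4 (ii)] [cite: Krause2021, Lemma 13.1.26] -/
theorem socleLength_psMod {a₁ a₂ : ℤ} (h₁ : lc s lam a₁ = 0) (h₂ : lc s lam a₂ = 0) (h₁₂ : a₁ + a₂ = s + 1) (hlt : a₁ < a₂) :
    SocleRadical.socleLength (GKRing G11) (psMod s lam) = 3 := by
  have h := socleLength_psMod_eq_length (s := s) (lam := lam)
  rw [length_eq_three h₁ h₂ h₁₂ hlt] at h
  exact_mod_cast h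

/-- `ht(P) = 2` at a double zero. [cite: Bump1997, Thm. 2.5.4 (ii)] [cite: Krause2021, Lemma 13.1.26] -/
theorem socleLength_psMod₂ {a₀ : ℤ} (h : lc s lam a₀ = 0) (h2 : 2 * a₀ = s + 1) :
    SocleRadical.socleLength (GKRing G11) (psMod s lam) = 2 := by
  have h' := socleLength_psMod_eq_length (s := s) (lam := lam)
  rw [length_eq_two h h2] at h'
  exact_mod_cast h'

/-- `ht(P) = 1` for irreducible `P(s, λ)`. [cite: Bump1997, Thm. 2.5.3 (i)] [cite: Krause2021, Lemma 13.1.26] -/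
theorem socleLength_psMod_of_irreducible (hirr : ∀ a : ℤ, lc s lam a ≠ 0) :
    SocleRadical.socleLength (GKRing G11) (psMod s lam) = 1 := by
  have h' := socleLength_psMod_eq_length (s := s) (lam := lam)
  rw [length_eq_one hirr] at h'
  exact_mod_cast h'

/-- The Loewy length equals the length, for every `P(s, λ)`. [cite: AndersonFuller1992, Lemma 32.1 (a)⇒(c)] [cite: Krause2021, Lemma 13.1.26] -/
theorem loewyLength_psMod_eq_length :
    (SocleRadical.loewyLength (GKRing G11) (psMod s lam) : ℕ∞) = Module.length (GKRing G11) (psMod s lam) := by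
  haveI := isArtinian_psMod (s := s) (lam := lam)
  haveI := isNoetherian_psMod (s := s) (lam := lam)
  exact isUniserial_psMod.loewyLength_eq_length

/-- **`soc² P = W(a₁)`** for two distinct zeros (the socle series is `0 ⋖ W(a₂) ⋖ W(a₁) ⋖ P`, the unique composition series `series₃`).
[cite: Bump1997, Thm. 2.5.3 (ii)–(iii)] [cite: AndersonFuller1992, Lemma 32.1 (a)⇒(b)] -/
theorem socleSeries_psMod_two {a₁ a₂ : ℤ} (h₁ : lc s lam a₁ = 0) (h₂ : lc s lam a₂ = 0) (h₁₂ : a₁ + a₂ = s + 1) (hlt : a₁ < a₂) :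
    SocleRadical.socleSeries (GKRing G11) (psMod s lam) 2 = upperR h₁ := by
  haveI := isArtinian_psMod (s := s) (lam := lam)
  have h := isUniserial_psMod.compositionSeries_eq_socleSeries (series₃ h₁ h₂ h₁₂ hlt) rfl ⟨2, by simp [series₃]⟩
  exact h.symm

/-! ## §3 Every composition series of `P(s, λ)` is the socle series -/

/-- **Every composition series of `P(s, λ)` starting at `0` is the socle series, term by term** (uniqueness of the composition series,
Anderson–Fuller (a)⇒(b), for all `s`, `λ`). [cite: AndersonFuller1992, Lemma 32.1 (a)⇒(b)] [cite: KnappVogan1995, App. A §3 Cor. A.27] -/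
theorem compositionSeries_eq_socleSeries_psMod (σ : CompositionSeries (Submodule (GKRing G11) (psMod s lam))) (hb : σ.head = ⊥)
    (i : Fin (σ.length + 1)) : σ i = SocleRadical.socleSeries (GKRing G11) (psMod s lam) i := by
  haveI := isArtinian_psMod (s := s) (lam := lam)
  exact isUniserial_psMod.compositionSeries_eq_socleSeries σ hb i

/-- … and its length is `ht(P) = ℓ(P)`. [cite: AndersonFuller1992, Lemma 32.1 (a)⇒(b)] [cite: KnappVogan1995, App. A §3 Cor. A.27] -/
theorem compositionSeries_length_eq_socleLength_psMod (σ : CompositionSeries (Submodule (GKRing G11) (psMod s lam)))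
    (hb : σ.head = ⊥) (ht : σ.last = ⊤) : σ.length = SocleRadical.socleLength (GKRing G11) (psMod s lam) := by
  haveI := isArtinian_psMod (s := s) (lam := lam)
  haveI := isNoetherian_psMod (s := s) (lam := lam)
  exact isUniserial_psMod.compositionSeries_length_eq σ hb ht

end Uniserial

end U11PS

end Literature.RepresentationTheory.BorelWallach2000
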